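import Summits.QuantumFields.YangMills.Theses.BalabanUVNodes
import Summits.QuantumFields.YangMills.Theorems.BalabanUVNodesN27AtShellSplitOfRecord13CoPHVCutProducers

/-!
# BalabanUVNodes ∕ N27 = binder B5 AT THE RECORD, leaf — K3⁷ `Theses.BalabanUVNodes.SpineGivenEndpointR13SepCoPH` IN v3's `PinnedAtLive jc sh cr` SHAPE WITH **EVERY K5 SLOT IN ITS
# PRODUCER'S CURRENCY** at `(jc, shellSplitOfRecord₁₃At 2 K₀ ρA ρB)`: N21 ⟸ dag-n21-d's (M1) rows (p593341), **N19′ ⟸ dag-n20-w3's LOWERED-THRESHOLD TERM SANDWICH** (p595768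
# `core_crOfRecord₁₃VAt_shellSplit_of_loweredTerm_liveSel`), N27x ∕ (H-U) ∕ `0 ≤ ζ` theorems, N20 a keyed witness — the K5 twin of leaf G∕IV's producer-currency K4 side
# (cell `pub-ymgap`, HUMAN RULING D-0062 Track A, R134 seat `pub-ymgap-dag-n27-c` (N27 B5 composite, s2) gen 12, HOME trigger (t2); plan g81 K3⁷ skeleton v3 02f6f498332fdbee;
# `--kind proof --supports stmt-QuantumFields-20544 --as helper`; COUNT-NEUTRAL; TWO theorems, 0 `def`, 0 `sorry`; a route-facing leaf, nothing may import it)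

WHAT THIS LEAF DISPLAYS (`N = 2`, guard `θ.ZhUnity F 2 ∧ θ.SlotsNondegenerate₁₃ F 2`, `hc := hP.toCore`).  THE ITEM from: an ARBITRARY rates predicate `P` at a keyed rate reading `rr` on
the whole guard (`hrates`); ON THE LIVE-SELECTOR LINE at `fun F θ hP g₀ os ↦ crOfRecord₁₃VAt K₀ (jc F θ hP g₀ os) (shellSplitOfRecord₁₃At 2 K₀ ρA ρB) F θ hP g₀ os`: the one law
`hζm`; N20 as a keyed `RelWeightBound` witness (`h20`); dag-n21-d's N21 rows (`hρA hρB hM1`); dag-n20-w3's N19′ rows VERBATIM (`0 < θ.τ9.M` supplied from `Admissible`) — the flow hypothesis `hR` (`RAgree` of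
the two runs' histories of record), the policy letters `hj : 1 ≤ jc … K ≤ K₀ + K`, the lowered widths' signs `hερ`, and `h19` = given the rates, a summable `δ` and per `K` one
constant `c` with the LOWERED-THRESHOLD SANDWICH of the two runs' (2.18) terms, term vs lifted term, on the run-A indices small-field at every level `≤ jc … K` (N19's NE7 core AT THE
RECORD — NOT PRINTED for d = 4, NOT proved); OFF THE LIVE LINE leaf D's four keyed faces at a free reading `cr'`.  Storey XP §1 on `guard ∧ LiveSel`, (P) at `cr'` on `guard ∧ ¬LiveSel`,
U `spine_rec13CCoPHOn_of_split`, XXXVIᶜᵒᵖᴴ `spine_rec13CCoPHOn_iff_forall_guarded`.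
★★★ §1 `spineGivenEndpointR13SepCoPH_of_liveShellSplitOfRecord₁₃VAt_cut_cubeAC_loweredTerm_offLive_keyedFacesP` · ★★★ §2 `…_cubeAC_vacuumTV_offLive_keyedFacesP` (N19′ ⟸ dag-n14-w2's
(V) vacuum bracket + node U3's TV read-out sentence at the V reading, `…N14BinderAtSpineReadingOfRecord13CoPHV`)
(the FIBRE-currency and zero-cut items are the sibling leaf `…ShellSplitOfRecordVProducersFibre`).

HONEST FRAMING.  NOT a discharge: a term of the item's type under displayed hypotheses (audit `proof.conditional`), every one inhabited for no family today (K0⁷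
`Record13SepCoPHInhabited` OPEN); the sandwich (N19's NE7 core at the record) and (M1) per top cube (N21's) are the producers' displayed estimates — NOT PRINTED for d = 4, NOT proved;
`RAgree`, `0 < M`, the policy∕width letters are the producers' letters ((α) READING banners verbatim: NC-NE7b-α unruled, A6 zero-width junk instance); `jc ρA ρB cr'` FREE; nothing of
Bałaban's asserted or instantiated; N19 ∕ N20 ∕ N21 ∕ N27 NOT discharged; K3⁷ NOT claimed closed; route rev 25 and skeleton v3 UNTOUCHED; counts UNMOVED (typed 28∕28 · discharged
5∕27, A 5∕28); one finite four-torus programme at fixed `ε` — NOT ℝ⁴, NOT infinite volume, NOT OS, NOT a mass gap, NOT Clay.  No decl below carries a cite tag.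
-/

set_option autoImplicit false

noncomputable section

namespace Summit.QuantumFields.YangMills.Theorems.BalabanUVNodesN27SpineRecord

open scoped BigOperators
open MeasureTheory
open Literature.MathematicalPhysics.QuantumFieldTheory.Balaban1983to89
open Literature.MathematicalPhysics.QuantumFieldTheory.Balaban1983to89.T4Continuum
open Literature.MathematicalPhysics.QuantumFieldTheory.Balaban1983to89.Node00
open T4WeightBudget (RelWeightBound)
open T4IndicatorShell (ShellWeightBound)
open T4ContinuumYM4Torus (ForSmallCouplings)
open Summit.QuantumFields.BalabanUV.T4Continuum.Spine
open Summit.QuantumFields.YangMills.Theses.BalabanUVNodes (SpineGivenEndpointR13SepCoPH)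
open YMDAG.UVSplit
open Summit.QuantumFields.YangMills.BalabanUVNodes.N19TargetClassWeightsE1Keyed
open Summit.QuantumFields.YangMills.Theorems.N21ShellSplitOfRecord13CoPH (WidthLetter₁₃CoPH shellSplitOfRecord₁₃At shellA₁₃ shellB₁₃ shellPieceOfDatum₉ cubeWeightOfDatum₉)
open YMDAG.N14.AtSpineReading13CoPH (classMeasA₁₃ classMeasB₁₃)
open YMDAG.N14.AtSpineReading13CoPH.Shell (shellMeasA₁₃ shellMeasB₁₃)

variable (K₀ : ℕ) (jc : (F : T4Family) → (θ : Stage13HParams F 2) → θ.Provisos₁₃CoPH F 2 → (ℕ → ℝ) → List (ULoop F) → ℕ → ℕ)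
  (ρA ρB : WidthLetter₁₃CoPH 2)
  (cr' : (F : T4Family) → (θ : Stage13HParams F 2) → θ.Provisos₁₃CoPH F 2 → (ℕ → ℝ) → List (ULoop F) → SpineCarriers)
  (rr : (F : T4Family) → (θ : Stage13HParams F 2) → θ.Provisos₁₃CoPH F 2 → (ℕ → ℝ) → List (ULoop F) → RateCarriers 2)
  (P : ∀ {F : T4Family}, Datum F 2 → RateCarriers 2 → Prop)

/-- ★★★ **K3⁷ IN v3's `PinnedAtLive` SHAPE AT `(jc, shellSplitOfRecord₁₃At 2 K₀ ρA ρB)` WITH EVERY K5 SLOT IN PRODUCER CURRENCY — N21 ⟸ dag-n21-d's (M1) rows, N19′ ⟸ dag-n20-w3's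
lowered-threshold term sandwich, N20 a keyed witness, N27x ∕ (H-U) ∕ `0 ≤ ζ` theorems** (storey XP §1 on `guard ∧ LiveSel`, (P) `spine_rec13CCoPHOn_of_keyedFacesP` at `cr'` on
`guard ∧ ¬LiveSel`, U `spine_rec13CCoPHOn_of_split`, `hc := hP.toCore`).  NOT a discharge: a term of the item's type under displayed hypotheses, each inhabited for no family today;
the sandwich and (M1) NOT PRINTED ∕ NOT proved; `jc ρA ρB` free. [bookkeeping] -/
theorem spineGivenEndpointR13SepCoPH_of_liveShellSplitOfRecord₁₃VAt_cut_cubeAC_loweredTerm_offLive_keyedFacesP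
    (hrates : ∀ (F : T4Family) (θ : Stage13HParams F 2) (hP : θ.Provisos₁₃CoPH F 2), (θ.ZhUnity F 2 ∧ θ.SlotsNondegenerate₁₃ F 2) → θ.Admissible F 2 → ∀ (g₀ : ℕ → ℝ) (os : List (ULoop F)),
      P (datumOfRecord₁₃CoPH F 2 θ hP) (rr F θ hP g₀ os))
    (hζm : ∀ (F : T4Family) (θ : Stage13HParams F 2), θ.Provisos₁₃CoPH F 2 → ((θ.ZhUnity F 2 ∧ θ.SlotsNondegenerate₁₃ F 2) ∧ θ.ppSel = ppSelLiveOfRecord F 2 θ.ν θ.τ9 (EOfRecord₁₃ F 2 θ.toStage13Params) (wOfRecord₉ F 2 θ.toStage9Params)) → θ.Admissible F 2 → ZetaMeasurable F 2 θ.ζ)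
    (h20 : ∀ (F : T4Family) (θ : Stage13HParams F 2) (hP : θ.Provisos₁₃CoPH F 2), ((θ.ZhUnity F 2 ∧ θ.SlotsNondegenerate₁₃ F 2) ∧ θ.ppSel = ppSelLiveOfRecord F 2 θ.ν θ.τ9 (EOfRecord₁₃ F 2 θ.toStage13Params) (wOfRecord₉ F 2 θ.toStage9Params)) → θ.Admissible F 2 → ∀ (g₀ : ℕ → ℝ) (os : List (ULoop F)),
      ∃ W : ℕ → ℝ, RelWeightBound 1 (classSet₁₃ θ K₀ g₀) (weightA₁₃ θ hP K₀ g₀ os) (weightB₁₃ θ hP K₀ g₀ os) (badClass₁₃ θ K₀ g₀ (jc F θ hP g₀ os)) W)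
    (hρA : ∀ (F : T4Family) (θ : Stage13HParams F 2) (hP : θ.Provisos₁₃CoPH F 2),
      ((θ.ZhUnity F 2 ∧ θ.SlotsNondegenerate₁₃ F 2) ∧ θ.ppSel = ppSelLiveOfRecord F 2 θ.ν θ.τ9 (EOfRecord₁₃ F 2 θ.toStage13Params) (wOfRecord₉ F 2 θ.toStage9Params)) → θ.Admissible F 2 →
        ∀ (g₀ : ℕ → ℝ) (os : List (ULoop F)) (K : ℕ), 0 ≤ ρA F θ hP g₀ os K)
    (hρB : ∀ (F : T4Family) (θ : Stage13HParams F 2) (hP : θ.Provisos₁₃CoPH F 2),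
      ((θ.ZhUnity F 2 ∧ θ.SlotsNondegenerate₁₃ F 2) ∧ θ.ppSel = ppSelLiveOfRecord F 2 θ.ν θ.τ9 (EOfRecord₁₃ F 2 θ.toStage13Params) (wOfRecord₉ F 2 θ.toStage9Params)) → θ.Admissible F 2 →
        ∀ (g₀ : ℕ → ℝ) (os : List (ULoop F)) (K : ℕ), 0 ≤ ρB F θ hP g₀ os K)
    (hM1 : ∀ (F : T4Family) (θ : Stage13HParams F 2) (hP : θ.Provisos₁₃CoPH F 2),
      ((θ.ZhUnity F 2 ∧ θ.SlotsNondegenerate₁₃ F 2) ∧ θ.ppSel = ppSelLiveOfRecord F 2 θ.ν θ.τ9 (EOfRecord₁₃ F 2 θ.toStage13Params) (wOfRecord₉ F 2 θ.toStage9Params)) → θ.Admissible F 2 →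
        ∀ (g₀ : ℕ → ℝ) (os : List (ULoop F)), ∃ DA DB : ℕ → ℝ, (∀ K, 0 ≤ DA K) ∧ (∀ K, 0 ≤ DB K) ∧
          Summable (fun K => DA K * ρA F θ hP g₀ os K) ∧ Summable (fun K => DB K * ρB F θ hP g₀ os K) ∧
          (∀ (K : ℕ) (t : ℝ), |t| ≤ 1 →
            ∀ a : ↥(cubeIndices (F.P (K₀ + K)) (cubeSide (F.P (K₀ + K)).L θ.ν.M₂ (RkOfRecord (F.P (K₀ + K)).L θ.ν.r (histA₁₃ θ K₀ g₀ K (K₀ + K))) (K₀ + K))),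
              ∑ s, shellPieceOfDatum₉ F 2 θ.toStage9Params (datumOfRecord₁₃CoPH F 2 θ hP) g₀ os (runA₁₃ F K₀ g₀ K) (histA₁₃ θ K₀ g₀ K) (K₀ + K)
                  (ρA F θ hP g₀ os K) t a s ≤
                (DA K * ρA F θ hP g₀ os K) *
                  ∑ s, cubeWeightOfDatum₉ F 2 θ.toStage9Params (datumOfRecord₁₃CoPH F 2 θ hP) g₀ os (runA₁₃ F K₀ g₀ K) (histA₁₃ θ K₀ g₀ K) (K₀ + K) t a s) ∧
          (∀ (K : ℕ) (t : ℝ), |t| ≤ 1 →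
            ∀ a : ↥(cubeIndices (F.P (K₀ + K + 1)) (cubeSide (F.P (K₀ + K + 1)).L θ.ν.M₂
                (RkOfRecord (F.P (K₀ + K + 1)).L θ.ν.r (histB₁₃ θ K₀ g₀ K (K₀ + K + 1))) (K₀ + K + 1))),
              ∑ s', shellPieceOfDatum₉ F 2 θ.toStage9Params (datumOfRecord₁₃CoPH F 2 θ hP) g₀ os (runB₁₃ F K₀ g₀ K) (histB₁₃ θ K₀ g₀ K) (K₀ + K + 1)
                  (ρB F θ hP g₀ os K) t a s' ≤
                (DB K * ρB F θ hP g₀ os K) *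
                  ∑ s', cubeWeightOfDatum₉ F 2 θ.toStage9Params (datumOfRecord₁₃CoPH F 2 θ hP) g₀ os (runB₁₃ F K₀ g₀ K) (histB₁₃ θ K₀ g₀ K) (K₀ + K + 1) t a s'))
    (hR : ∀ (F : T4Family) (θ : Stage13HParams F 2) (hP : θ.Provisos₁₃CoPH F 2), ((θ.ZhUnity F 2 ∧ θ.SlotsNondegenerate₁₃ F 2) ∧ θ.ppSel = ppSelLiveOfRecord F 2 θ.ν θ.τ9 (EOfRecord₁₃ F 2 θ.toStage13Params) (wOfRecord₉ F 2 θ.toStage9Params)) → θ.Admissible F 2 →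
      ∀ (g₀ : ℕ → ℝ) (K : ℕ), RAgree F θ.ν (histA₁₃ θ K₀ g₀ K) (histB₁₃ θ K₀ g₀ K) (K₀ + K))
    (hj : ∀ (F : T4Family) (θ : Stage13HParams F 2) (hP : θ.Provisos₁₃CoPH F 2), ((θ.ZhUnity F 2 ∧ θ.SlotsNondegenerate₁₃ F 2) ∧ θ.ppSel = ppSelLiveOfRecord F 2 θ.ν θ.τ9 (EOfRecord₁₃ F 2 θ.toStage13Params) (wOfRecord₉ F 2 θ.toStage9Params)) → θ.Admissible F 2 →
      ∀ (g₀ : ℕ → ℝ) (os : List (ULoop F)) (K : ℕ), 1 ≤ jc F θ hP g₀ os K ∧ jc F θ hP g₀ os K ≤ K₀ + K)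
    (hερ : ∀ (F : T4Family) (θ : Stage13HParams F 2) (hP : θ.Provisos₁₃CoPH F 2), ((θ.ZhUnity F 2 ∧ θ.SlotsNondegenerate₁₃ F 2) ∧ θ.ppSel = ppSelLiveOfRecord F 2 θ.ν θ.τ9 (EOfRecord₁₃ F 2 θ.toStage13Params) (wOfRecord₉ F 2 θ.toStage9Params)) → θ.Admissible F 2 →
      ∀ (g₀ : ℕ → ℝ) (os : List (ULoop F)) (K : ℕ), 0 ≤ epsOfRecord θ.ν (histA₁₃ θ K₀ g₀ K) (K₀ + K) * ρA F θ hP g₀ os K ∧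
        0 ≤ epsOfRecord θ.ν (histB₁₃ θ K₀ g₀ K) (K₀ + K + 1) * ρB F θ hP g₀ os K)
    (h19 : ∀ (F : T4Family) (θ : Stage13HParams F 2) (hP : θ.Provisos₁₃CoPH F 2) (hRg : ((θ.ZhUnity F 2 ∧ θ.SlotsNondegenerate₁₃ F 2) ∧ θ.ppSel = ppSelLiveOfRecord F 2 θ.ν θ.τ9 (EOfRecord₁₃ F 2 θ.toStage13Params) (wOfRecord₉ F 2 θ.toStage9Params))) (hθ : θ.Admissible F 2)
      (g₀ : ℕ → ℝ) (os : List (ULoop F)), P (datumOfRecord₁₃CoPH F 2 θ hP) (rr F θ hP g₀ os) →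
        ∃ δ : ℕ → ℝ, Summable δ ∧ ∀ K : ℕ, ∃ c : ℝ, ∀ t : ℝ, |t| ≤ 1 → ∀ s : SeqOfRecord F θ.ν θ.τ9.M (histA₁₃ θ K₀ g₀ K) (K₀ + K) (K₀ + K),
          (∀ j, 1 ≤ j → j ≤ jc F θ hP g₀ os K → s.Λ j = Set.univ) →
          Real.exp (c - F.side ^ 4 * δ K) *
                (∫ V, chiSeqOfRecordAt F 2 θ.ν θ.τ9.M (histA₁₃ θ K₀ g₀ K) (K₀ + K) (K₀ + K)
                    (epsOfRecord θ.ν (histA₁₃ θ K₀ g₀ K) (K₀ + K) * (1 - ρA F θ hP g₀ os K)) s V *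
                  dressedSlotsOfDatum₉ F 2 θ.toStage9Params (datumOfRecord₁₃CoPH F 2 θ hP) g₀ os t (runA₁₃ F K₀ g₀ K) (histA₁₃ θ K₀ g₀ K) (K₀ + K) s V
                  ∂fieldMeasure (F.P (K₀ + K)) (K₀ + K) (Node00.SU 2))
              ≤ (∫ V, chiSeqOfRecordAt F 2 θ.ν θ.τ9.M (histB₁₃ θ K₀ g₀ K) (K₀ + K + 1) (K₀ + K + 1)
                    (epsOfRecord θ.ν (histB₁₃ θ K₀ g₀ K) (K₀ + K + 1) * (1 - ρB F θ hP g₀ os K)) (liftSeq F θ.ν hθ.toStage9.2.2.2 (hR F θ hP hRg hθ g₀ K) s) V *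
                  dressedSlotsOfDatum₉ F 2 θ.toStage9Params (datumOfRecord₁₃CoPH F 2 θ hP) g₀ os t (runB₁₃ F K₀ g₀ K) (histB₁₃ θ K₀ g₀ K) (K₀ + K + 1)
                    (liftSeq F θ.ν hθ.toStage9.2.2.2 (hR F θ hP hRg hθ g₀ K) s) V
                  ∂fieldMeasure (F.P (K₀ + K + 1)) (K₀ + K + 1) (Node00.SU 2)) ∧
            (∫ V, chiSeqOfRecordAt F 2 θ.ν θ.τ9.M (histB₁₃ θ K₀ g₀ K) (K₀ + K + 1) (K₀ + K + 1)
                    (epsOfRecord θ.ν (histB₁₃ θ K₀ g₀ K) (K₀ + K + 1) * (1 - ρB F θ hP g₀ os K)) (liftSeq F θ.ν hθ.toStage9.2.2.2 (hR F θ hP hRg hθ g₀ K) s) V *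
                  dressedSlotsOfDatum₉ F 2 θ.toStage9Params (datumOfRecord₁₃CoPH F 2 θ hP) g₀ os t (runB₁₃ F K₀ g₀ K) (histB₁₃ θ K₀ g₀ K) (K₀ + K + 1)
                    (liftSeq F θ.ν hθ.toStage9.2.2.2 (hR F θ hP hRg hθ g₀ K) s) V
                  ∂fieldMeasure (F.P (K₀ + K + 1)) (K₀ + K + 1) (Node00.SU 2))
              ≤ Real.exp (c + F.side ^ 4 * δ K) *
                (∫ V, chiSeqOfRecordAt F 2 θ.ν θ.τ9.M (histA₁₃ θ K₀ g₀ K) (K₀ + K) (K₀ + K)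
                    (epsOfRecord θ.ν (histA₁₃ θ K₀ g₀ K) (K₀ + K) * (1 - ρA F θ hP g₀ os K)) s V *
                  dressedSlotsOfDatum₉ F 2 θ.toStage9Params (datumOfRecord₁₃CoPH F 2 θ hP) g₀ os t (runA₁₃ F K₀ g₀ K) (histA₁₃ θ K₀ g₀ K) (K₀ + K) s V
                  ∂fieldMeasure (F.P (K₀ + K)) (K₀ + K) (Node00.SU 2)))
    (h20' : ∀ (F : T4Family) (θ : Stage13HParams F 2) (hP : θ.Provisos₁₃CoPH F 2), ((θ.ZhUnity F 2 ∧ θ.SlotsNondegenerate₁₃ F 2) ∧ ¬ θ.ppSel = ppSelLiveOfRecord F 2 θ.ν θ.τ9 (EOfRecord₁₃ F 2 θ.toStage13Params) (wOfRecord₉ F 2 θ.toStage9Params)) → θ.Admissible F 2 → ∀ (g₀ : ℕ → ℝ) (os : List (ULoop F)),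
      RelWeightBound (cr' F θ hP g₀ os).l₀ (cr' F θ hP g₀ os).T (cr' F θ hP g₀ os).A (cr' F θ hP g₀ os).B (cr' F θ hP g₀ os).Bad (cr' F θ hP g₀ os).W)
    (h21' : ∀ (F : T4Family) (θ : Stage13HParams F 2) (hP : θ.Provisos₁₃CoPH F 2), ((θ.ZhUnity F 2 ∧ θ.SlotsNondegenerate₁₃ F 2) ∧ ¬ θ.ppSel = ppSelLiveOfRecord F 2 θ.ν θ.τ9 (EOfRecord₁₃ F 2 θ.toStage13Params) (wOfRecord₉ F 2 θ.toStage9Params)) → θ.Admissible F 2 → ∀ (g₀ : ℕ → ℝ) (os : List (ULoop F)),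
      ShellWeightBound (cr' F θ hP g₀ os).l₀ (cr' F θ hP g₀ os).T (cr' F θ hP g₀ os).A (cr' F θ hP g₀ os).B (cr' F θ hP g₀ os).shA (cr' F θ hP g₀ os).shB
        (cr' F θ hP g₀ os).Wsh)
    (hx' : ∀ (F : T4Family) (θ : Stage13HParams F 2) (hP : θ.Provisos₁₃CoPH F 2), ((θ.ZhUnity F 2 ∧ θ.SlotsNondegenerate₁₃ F 2) ∧ ¬ θ.ppSel = ppSelLiveOfRecord F 2 θ.ν θ.τ9 (EOfRecord₁₃ F 2 θ.toStage13Params) (wOfRecord₉ F 2 θ.toStage9Params)) → θ.Admissible F 2 →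
      B16.EndStatementBPrinted (datumOfRecord₁₃CoPH F 2 θ hP).C → DagBinding.EndpointExistence (datumOfRecord₁₃CoPH F 2 θ hP).C.toB12 →
        ForSmallCouplings (datumOfRecord₁₃CoPH F 2 θ hP) fun g₀ => ∀ os : List (ULoop F),
          0 < (cr' F θ hP g₀ os).l₀ ∧ 0 < (cr' F θ hP g₀ os).vol ∧
          (∀ (K : ℕ) (t : ℝ), |t| ≤ (cr' F θ hP g₀ os).l₀ →
            T4GenFunBounds.schemeZ ((datumOfRecord₁₃CoPH F 2 θ hP).scheme g₀) os ((cr' F θ hP g₀ os).K₀ + K) t =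
              ∑ τ ∈ (cr' F θ hP g₀ os).T K, (cr' F θ hP g₀ os).A K t τ) ∧
          (∀ (K : ℕ) (t : ℝ), |t| ≤ (cr' F θ hP g₀ os).l₀ →
            T4GenFunBounds.schemeZ ((datumOfRecord₁₃CoPH F 2 θ hP).scheme g₀) os ((cr' F θ hP g₀ os).K₀ + K + 1) t =
              ∑ τ ∈ (cr' F θ hP g₀ os).T K, (cr' F θ hP g₀ os).B K t τ))
    (h19' : ∀ (F : T4Family) (θ : Stage13HParams F 2) (hP : θ.Provisos₁₃CoPH F 2), ((θ.ZhUnity F 2 ∧ θ.SlotsNondegenerate₁₃ F 2) ∧ ¬ θ.ppSel = ppSelLiveOfRecord F 2 θ.ν θ.τ9 (EOfRecord₁₃ F 2 θ.toStage13Params) (wOfRecord₉ F 2 θ.toStage9Params)) → θ.Admissible F 2 → ∀ (g₀ : ℕ → ℝ) (os : List (ULoop F)),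
      P (datumOfRecord₁₃CoPH F 2 θ hP) (rr F θ hP g₀ os) → letI := (cr' F θ hP g₀ os).dec
        ∃ δ : ℕ → ℝ, NE7.Core (cr' F θ hP g₀ os).l₀ (cr' F θ hP g₀ os).vol (cr' F θ hP g₀ os).T (cr' F θ hP g₀ os).Bad
          (fun K t τ => (cr' F θ hP g₀ os).A K t τ - (cr' F θ hP g₀ os).shA K t τ) (fun K t τ => (cr' F θ hP g₀ os).B K t τ - (cr' F θ hP g₀ os).shB K t τ) δ ∧
          Summable δ) :
    SpineGivenEndpointR13SepCoPH :=
  fun F θ hP hG hθ _ _ =>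
    (spine_rec13CCoPHOn_iff_forall_guarded (fun F θ => θ.ZhUnity F 2 ∧ θ.SlotsNondegenerate₁₃ F 2)).mp
      (spine_rec13CCoPHOn_of_split (fun F θ => θ.ZhUnity F 2 ∧ θ.SlotsNondegenerate₁₃ F 2)
        (fun F (θ : Stage13HParams F 2) => θ.ppSel = ppSelLiveOfRecord F 2 θ.ν θ.τ9 (EOfRecord₁₃ F 2 θ.toStage13Params) (wOfRecord₉ F 2 θ.toStage9Params))
        (spine_rec13CCoPHOn_live_at_shellSplitOfRecord₁₃VAt_cut_of_keyedFacesP_cubeAC_loweredTerm K₀ jc ρA ρB (fun F θ => θ.ZhUnity F 2 ∧ θ.SlotsNondegenerate₁₃ F 2) rr P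
          hζm h20 hρA hρB hM1 (fun F θ hP hRg hθ => hrates F θ hP hRg.1 hθ) hR hj hερ h19)
        (spine_rec13CCoPHOn_of_keyedFacesP (cr := cr') (rr := rr)
          (Rg := fun F θ => (θ.ZhUnity F 2 ∧ θ.SlotsNondegenerate₁₃ F 2) ∧ ¬ θ.ppSel = ppSelLiveOfRecord F 2 θ.ν θ.τ9 (EOfRecord₁₃ F 2 θ.toStage13Params) (wOfRecord₉ F 2 θ.toStage9Params)) (P := P)
          h20' h21' (fun F θ hP hRg hθ => hrates F θ hP hRg.1 hθ) h19' hx'))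
      F θ hP.toCore hG hθ


/-! ## §2 N19′ in dag-n14-w2's (V) + U3-TV currency -/

/-- ★★★ **K3⁷ IN v3's `PinnedAtLive` SHAPE AT `(jc, shellSplitOfRecord₁₃At 2 K₀ ρA ρB)` — N21 ⟸ dag-n21-d's (M1) rows, N19′ ⟸ dag-n14-w2's (V) VACUUM BRACKET + node U3's TV READ-OUT
SENTENCE on the shell-free class laws of record (`core_crOfRecord₁₃VAt_shellSplitOfRecord_of_coreZero_of_tv`), N20 a keyed witness, N27x ∕ (H-U) ∕ `0 ≤ ζ` theorems** (storey XP §2 on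
`guard ∧ LiveSel`, (P) at `cr'` on `guard ∧ ¬LiveSel`, U's split, `hc := hP.toCore`).  NOT a discharge; (V), the TV sentence and (M1) are HYPOTHESIS SHAPES produced by nobody, NOT
PRINTED for d = 4, NOT proved. [bookkeeping] -/
theorem spineGivenEndpointR13SepCoPH_of_liveShellSplitOfRecord₁₃VAt_cut_cubeAC_vacuumTV_offLive_keyedFacesP
    (hrates : ∀ (F : T4Family) (θ : Stage13HParams F 2) (hP : θ.Provisos₁₃CoPH F 2), (θ.ZhUnity F 2 ∧ θ.SlotsNondegenerate₁₃ F 2) → θ.Admissible F 2 → ∀ (g₀ : ℕ → ℝ) (os : List (ULoop F)),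
      P (datumOfRecord₁₃CoPH F 2 θ hP) (rr F θ hP g₀ os))
    (hζm : ∀ (F : T4Family) (θ : Stage13HParams F 2), θ.Provisos₁₃CoPH F 2 → ((θ.ZhUnity F 2 ∧ θ.SlotsNondegenerate₁₃ F 2) ∧ θ.ppSel = ppSelLiveOfRecord F 2 θ.ν θ.τ9 (EOfRecord₁₃ F 2 θ.toStage13Params) (wOfRecord₉ F 2 θ.toStage9Params)) → θ.Admissible F 2 → ZetaMeasurable F 2 θ.ζ)
    (h20 : ∀ (F : T4Family) (θ : Stage13HParams F 2) (hP : θ.Provisos₁₃CoPH F 2), ((θ.ZhUnity F 2 ∧ θ.SlotsNondegenerate₁₃ F 2) ∧ θ.ppSel = ppSelLiveOfRecord F 2 θ.ν θ.τ9 (EOfRecord₁₃ F 2 θ.toStage13Params) (wOfRecord₉ F 2 θ.toStage9Params)) → θ.Admissible F 2 → ∀ (g₀ : ℕ → ℝ) (os : List (ULoop F)),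
      ∃ W : ℕ → ℝ, RelWeightBound 1 (classSet₁₃ θ K₀ g₀) (weightA₁₃ θ hP K₀ g₀ os) (weightB₁₃ θ hP K₀ g₀ os) (badClass₁₃ θ K₀ g₀ (jc F θ hP g₀ os)) W)
    (hρA : ∀ (F : T4Family) (θ : Stage13HParams F 2) (hP : θ.Provisos₁₃CoPH F 2),
      ((θ.ZhUnity F 2 ∧ θ.SlotsNondegenerate₁₃ F 2) ∧ θ.ppSel = ppSelLiveOfRecord F 2 θ.ν θ.τ9 (EOfRecord₁₃ F 2 θ.toStage13Params) (wOfRecord₉ F 2 θ.toStage9Params)) → θ.Admissible F 2 →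
        ∀ (g₀ : ℕ → ℝ) (os : List (ULoop F)) (K : ℕ), 0 ≤ ρA F θ hP g₀ os K)
    (hρB : ∀ (F : T4Family) (θ : Stage13HParams F 2) (hP : θ.Provisos₁₃CoPH F 2),
      ((θ.ZhUnity F 2 ∧ θ.SlotsNondegenerate₁₃ F 2) ∧ θ.ppSel = ppSelLiveOfRecord F 2 θ.ν θ.τ9 (EOfRecord₁₃ F 2 θ.toStage13Params) (wOfRecord₉ F 2 θ.toStage9Params)) → θ.Admissible F 2 →
        ∀ (g₀ : ℕ → ℝ) (os : List (ULoop F)) (K : ℕ), 0 ≤ ρB F θ hP g₀ os K)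
    (hM1 : ∀ (F : T4Family) (θ : Stage13HParams F 2) (hP : θ.Provisos₁₃CoPH F 2),
      ((θ.ZhUnity F 2 ∧ θ.SlotsNondegenerate₁₃ F 2) ∧ θ.ppSel = ppSelLiveOfRecord F 2 θ.ν θ.τ9 (EOfRecord₁₃ F 2 θ.toStage13Params) (wOfRecord₉ F 2 θ.toStage9Params)) → θ.Admissible F 2 →
        ∀ (g₀ : ℕ → ℝ) (os : List (ULoop F)), ∃ DA DB : ℕ → ℝ, (∀ K, 0 ≤ DA K) ∧ (∀ K, 0 ≤ DB K) ∧
          Summable (fun K => DA K * ρA F θ hP g₀ os K) ∧ Summable (fun K => DB K * ρB F θ hP g₀ os K) ∧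
          (∀ (K : ℕ) (t : ℝ), |t| ≤ 1 →
            ∀ a : ↥(cubeIndices (F.P (K₀ + K)) (cubeSide (F.P (K₀ + K)).L θ.ν.M₂ (RkOfRecord (F.P (K₀ + K)).L θ.ν.r (histA₁₃ θ K₀ g₀ K (K₀ + K))) (K₀ + K))),
              ∑ s, shellPieceOfDatum₉ F 2 θ.toStage9Params (datumOfRecord₁₃CoPH F 2 θ hP) g₀ os (runA₁₃ F K₀ g₀ K) (histA₁₃ θ K₀ g₀ K) (K₀ + K)
                  (ρA F θ hP g₀ os K) t a s ≤
                (DA K * ρA F θ hP g₀ os K) *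
                  ∑ s, cubeWeightOfDatum₉ F 2 θ.toStage9Params (datumOfRecord₁₃CoPH F 2 θ hP) g₀ os (runA₁₃ F K₀ g₀ K) (histA₁₃ θ K₀ g₀ K) (K₀ + K) t a s) ∧
          (∀ (K : ℕ) (t : ℝ), |t| ≤ 1 →
            ∀ a : ↥(cubeIndices (F.P (K₀ + K + 1)) (cubeSide (F.P (K₀ + K + 1)).L θ.ν.M₂
                (RkOfRecord (F.P (K₀ + K + 1)).L θ.ν.r (histB₁₃ θ K₀ g₀ K (K₀ + K + 1))) (K₀ + K + 1))),
              ∑ s', shellPieceOfDatum₉ F 2 θ.toStage9Params (datumOfRecord₁₃CoPH F 2 θ hP) g₀ os (runB₁₃ F K₀ g₀ K) (histB₁₃ θ K₀ g₀ K) (K₀ + K + 1)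
                  (ρB F θ hP g₀ os K) t a s' ≤
                (DB K * ρB F θ hP g₀ os K) *
                  ∑ s', cubeWeightOfDatum₉ F 2 θ.toStage9Params (datumOfRecord₁₃CoPH F 2 θ hP) g₀ os (runB₁₃ F K₀ g₀ K) (histB₁₃ θ K₀ g₀ K) (K₀ + K + 1) t a s'))
    (h19 : ∀ (F : T4Family) (θ : Stage13HParams F 2) (hP : θ.Provisos₁₃CoPH F 2), ((θ.ZhUnity F 2 ∧ θ.SlotsNondegenerate₁₃ F 2) ∧ θ.ppSel = ppSelLiveOfRecord F 2 θ.ν θ.τ9 (EOfRecord₁₃ F 2 θ.toStage13Params) (wOfRecord₉ F 2 θ.toStage9Params)) → θ.Admissible F 2 →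
      ∀ (g₀ : ℕ → ℝ) (os : List (ULoop F)), P (datumOfRecord₁₃CoPH F 2 θ hP) (rr F θ hP g₀ os) → letI : DecidableEq (Σ K, SiteSeqKey F (K₀ + K)) := Classical.decEq _
        ∃ δ₀ ρ : ℕ → ℝ, Summable δ₀ ∧ Summable ρ ∧
          NE7.Core 1 ((F.side : ℝ) ^ 4) (classSet₁₃ θ K₀ g₀) (badClass₁₃ θ K₀ g₀ (jc F θ hP g₀ os))
            (fun K _ x => weightA₁₃ θ hP K₀ g₀ os K 0 x - shellA₁₃ θ hP K₀ g₀ os (ρA F θ hP g₀ os) K 0 x)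
            (fun K _ x => weightB₁₃ θ hP K₀ g₀ os K 0 x - shellB₁₃ θ hP K₀ g₀ os (ρB F θ hP g₀ os) K 0 x) δ₀ ∧
          (∀ (K : ℕ) (t : ℝ), |t| ≤ 1 → ∀ x ∈ classSet₁₃ θ K₀ g₀ K \ badClass₁₃ θ K₀ g₀ (jc F θ hP g₀ os) K t, ∀ S : Set (GaugeField (F.P 0) 0 (Node00.SU 2)), MeasurableSet S →
            |((classMeasB₁₃ θ K₀ g₀ K x - shellMeasB₁₃ θ K₀ g₀ (ρB F θ hP g₀ os) K x).map
                      ((T4RunLadder.unitFactorisation (datumOfRecord₁₃CoPH F 2 θ hP) (isPrintedAveraged_datumOfRecord₁₃CoPH F 2 θ hP).avgMeasurable g₀).A (K₀ + K + 1))).real S /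
                    ((classMeasB₁₃ θ K₀ g₀ K x - shellMeasB₁₃ θ K₀ g₀ (ρB F θ hP g₀ os) K x).map
                      ((T4RunLadder.unitFactorisation (datumOfRecord₁₃CoPH F 2 θ hP) (isPrintedAveraged_datumOfRecord₁₃CoPH F 2 θ hP).avgMeasurable g₀).A (K₀ + K + 1))).real Set.univ -
                  ((classMeasA₁₃ θ K₀ g₀ K x - shellMeasA₁₃ θ K₀ g₀ (ρA F θ hP g₀ os) K x).map
                      ((T4RunLadder.unitFactorisation (datumOfRecord₁₃CoPH F 2 θ hP) (isPrintedAveraged_datumOfRecord₁₃CoPH F 2 θ hP).avgMeasurable g₀).A (K₀ + K))).real S /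
                    ((classMeasA₁₃ θ K₀ g₀ K x - shellMeasA₁₃ θ K₀ g₀ (ρA F θ hP g₀ os) K x).map
                      ((T4RunLadder.unitFactorisation (datumOfRecord₁₃CoPH F 2 θ hP) (isPrintedAveraged_datumOfRecord₁₃CoPH F 2 θ hP).avgMeasurable g₀).A (K₀ + K))).real Set.univ| ≤
                  ρ K))
    (h20' : ∀ (F : T4Family) (θ : Stage13HParams F 2) (hP : θ.Provisos₁₃CoPH F 2), ((θ.ZhUnity F 2 ∧ θ.SlotsNondegenerate₁₃ F 2) ∧ ¬ θ.ppSel = ppSelLiveOfRecord F 2 θ.ν θ.τ9 (EOfRecord₁₃ F 2 θ.toStage13Params) (wOfRecord₉ F 2 θ.toStage9Params)) → θ.Admissible F 2 → ∀ (g₀ : ℕ → ℝ) (os : List (ULoop F)),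
      RelWeightBound (cr' F θ hP g₀ os).l₀ (cr' F θ hP g₀ os).T (cr' F θ hP g₀ os).A (cr' F θ hP g₀ os).B (cr' F θ hP g₀ os).Bad (cr' F θ hP g₀ os).W)
    (h21' : ∀ (F : T4Family) (θ : Stage13HParams F 2) (hP : θ.Provisos₁₃CoPH F 2), ((θ.ZhUnity F 2 ∧ θ.SlotsNondegenerate₁₃ F 2) ∧ ¬ θ.ppSel = ppSelLiveOfRecord F 2 θ.ν θ.τ9 (EOfRecord₁₃ F 2 θ.toStage13Params) (wOfRecord₉ F 2 θ.toStage9Params)) → θ.Admissible F 2 → ∀ (g₀ : ℕ → ℝ) (os : List (ULoop F)),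
      ShellWeightBound (cr' F θ hP g₀ os).l₀ (cr' F θ hP g₀ os).T (cr' F θ hP g₀ os).A (cr' F θ hP g₀ os).B (cr' F θ hP g₀ os).shA (cr' F θ hP g₀ os).shB
        (cr' F θ hP g₀ os).Wsh)
    (hx' : ∀ (F : T4Family) (θ : Stage13HParams F 2) (hP : θ.Provisos₁₃CoPH F 2), ((θ.ZhUnity F 2 ∧ θ.SlotsNondegenerate₁₃ F 2) ∧ ¬ θ.ppSel = ppSelLiveOfRecord F 2 θ.ν θ.τ9 (EOfRecord₁₃ F 2 θ.toStage13Params) (wOfRecord₉ F 2 θ.toStage9Params)) → θ.Admissible F 2 →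
      B16.EndStatementBPrinted (datumOfRecord₁₃CoPH F 2 θ hP).C → DagBinding.EndpointExistence (datumOfRecord₁₃CoPH F 2 θ hP).C.toB12 →
        ForSmallCouplings (datumOfRecord₁₃CoPH F 2 θ hP) fun g₀ => ∀ os : List (ULoop F),
          0 < (cr' F θ hP g₀ os).l₀ ∧ 0 < (cr' F θ hP g₀ os).vol ∧
          (∀ (K : ℕ) (t : ℝ), |t| ≤ (cr' F θ hP g₀ os).l₀ →
            T4GenFunBounds.schemeZ ((datumOfRecord₁₃CoPH F 2 θ hP).scheme g₀) os ((cr' F θ hP g₀ os).K₀ + K) t =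
              ∑ τ ∈ (cr' F θ hP g₀ os).T K, (cr' F θ hP g₀ os).A K t τ) ∧
          (∀ (K : ℕ) (t : ℝ), |t| ≤ (cr' F θ hP g₀ os).l₀ →
            T4GenFunBounds.schemeZ ((datumOfRecord₁₃CoPH F 2 θ hP).scheme g₀) os ((cr' F θ hP g₀ os).K₀ + K + 1) t =
              ∑ τ ∈ (cr' F θ hP g₀ os).T K, (cr' F θ hP g₀ os).B K t τ))
    (h19' : ∀ (F : T4Family) (θ : Stage13HParams F 2) (hP : θ.Provisos₁₃CoPH F 2), ((θ.ZhUnity F 2 ∧ θ.SlotsNondegenerate₁₃ F 2) ∧ ¬ θ.ppSel = ppSelLiveOfRecord F 2 θ.ν θ.τ9 (EOfRecord₁₃ F 2 θ.toStage13Params) (wOfRecord₉ F 2 θ.toStage9Params)) → θ.Admissible F 2 → ∀ (g₀ : ℕ → ℝ) (os : List (ULoop F)),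
      P (datumOfRecord₁₃CoPH F 2 θ hP) (rr F θ hP g₀ os) → letI := (cr' F θ hP g₀ os).dec
        ∃ δ : ℕ → ℝ, NE7.Core (cr' F θ hP g₀ os).l₀ (cr' F θ hP g₀ os).vol (cr' F θ hP g₀ os).T (cr' F θ hP g₀ os).Bad
          (fun K t τ => (cr' F θ hP g₀ os).A K t τ - (cr' F θ hP g₀ os).shA K t τ) (fun K t τ => (cr' F θ hP g₀ os).B K t τ - (cr' F θ hP g₀ os).shB K t τ) δ ∧
          Summable δ) :
    SpineGivenEndpointR13SepCoPH :=
  fun F θ hP hG hθ _ _ =>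
    (spine_rec13CCoPHOn_iff_forall_guarded (fun F θ => θ.ZhUnity F 2 ∧ θ.SlotsNondegenerate₁₃ F 2)).mp
      (spine_rec13CCoPHOn_of_split (fun F θ => θ.ZhUnity F 2 ∧ θ.SlotsNondegenerate₁₃ F 2)
        (fun F (θ : Stage13HParams F 2) => θ.ppSel = ppSelLiveOfRecord F 2 θ.ν θ.τ9 (EOfRecord₁₃ F 2 θ.toStage13Params) (wOfRecord₉ F 2 θ.toStage9Params))
        (spine_rec13CCoPHOn_live_at_shellSplitOfRecord₁₃VAt_cut_of_keyedFacesP_cubeAC_vacuumTV K₀ jc ρA ρB (fun F θ => θ.ZhUnity F 2 ∧ θ.SlotsNondegenerate₁₃ F 2) rr P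
          hζm h20 hρA hρB hM1 (fun F θ hP hRg hθ => hrates F θ hP hRg.1 hθ) h19)
        (spine_rec13CCoPHOn_of_keyedFacesP (cr := cr') (rr := rr)
          (Rg := fun F θ => (θ.ZhUnity F 2 ∧ θ.SlotsNondegenerate₁₃ F 2) ∧ ¬ θ.ppSel = ppSelLiveOfRecord F 2 θ.ν θ.τ9 (EOfRecord₁₃ F 2 θ.toStage13Params) (wOfRecord₉ F 2 θ.toStage9Params)) (P := P)
          h20' h21' (fun F θ hP hRg hθ => hrates F θ hP hRg.1 hθ) h19' hx'))
      F θ hP.toCore hG hθ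


end Summit.QuantumFields.YangMills.Theorems.BalabanUVNodesN27SpineRecord

end
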